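import Mathlib.Combinatorics.SimpleGraph.Acyclic
import Literature.AnabelianGeometry.SemiGraphs.PSCGraphicitySub
import Literature.AnabelianGeometry.SemiGraphs.DoubleCosetFibres
import HarnessLib

/-!
# [CombGC] Rmk. 1.1.3 / [IUTchI] Rmk. 1.2.3 (i): the coverings of a PSC datum are connected — `i(G_U) ≤ n(G_U) + 1` from generation by the vertex groups

Mochizuki, *A combinatorial version of the Grothendieck conjecture* [CombGC] §1, Def. 1.1 (i) p. 6 and
Rmk. 1.1.3 p. 8 ("`Π^grph_G` is a finitely generated, free pro-`Σ` group of rank `n(G) − i(G) + 1`"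
— a natural number: the dual semi-graph of a pointed stable curve, and of each of its finite étale
coverings, is CONNECTED) [cite: MochizukiCombGC2007, Rmk 1.1.3 p.8]; [IUTchI] Rmk. 1.2.3 (i) p. 41
(coverings of `G` are again of PSC-type, in particular connected) [cite: Mochizuki2012, IUTchI Rmk 1.2.3(i) p.41].

The cell types this input of the proof of [CombGC] Thm. 1.6 (ii)(iii) as the SUB-NODE STATEMENT
`PSCDatum.VertCountLeNodeCountSucc G : ∀ U open, vertCount U ≤ nodeCount U + 1` (abc-iut-w4-d052,
`PSCGraphicitySub.lean` statements IV; FACT-LIST F-3810 / origin form F-3811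
`VertCountLeNodeCountSuccHolds Ω`), a displayed hypothesis of every Thm. 1.6 kernel of the tree
(`unrVerticialIffHolds_of_inputs''`, `graphicIffFiltrationPreservingHolds_of_inputs''`, …).  Its
universal closure over the bare interface is FALSE (abc-iut-w5-d057's `twoPointDatum`: trivial group,
two vertices, no node).  This PROOF-ONLY file (no definitions) proves it from GROUP THEORY for every
datum whose representatives are what Def. 1.1 extracts from a graph of groups along a spanning tree:

* `vertCountLeNodeCountSucc_of_generate` — **criterion**: if the node groups admit TREE-ALIGNED
  representatives (`Π_e ≤ Π_{src e}` and `Π_e ≤ Π_{tgt e}` for an orientation `src, tgt` of the nodes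
  along which the vertex set is connected) and the vertex groups TOPOLOGICALLY GENERATE `Π` (compact),
  then `i(G_U) ≤ n(G_U) + 1` for every open `U`.  Proof (Bass–Serre): the finite coset graph `𝒯_U`
  (vertices `⊔_v U\Π/Π_v`, edges `⊔_e U\Π/Π_e`, `UgΠ_e ↦ (UgΠ_{src e}, UgΠ_{tgt e})`) is CONNECTED —
  the set of `g` all of whose vertices `UgΠ_v` lie in the component of `UΠ_{v₀}` contains `1`, is stable
  under right multiplication by every `Π_w` (translate the base chain by `g`; `UgwΠ_w = UgΠ_w`), hence
  contains the dense subgroup generated by the `Π_v`, and `U` is open — and a finite connected graph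
  has `#V ≤ #E + 1` (Mathlib's `SimpleGraph.Connected.card_vert_le_card_edgeSet_add_one`).
* `vertCountLeNodeCountSucc_of_twoVertex` — two-vertex data with a node, node groups in both vertex
  groups, `Π_{v₁} · Π_{v₂}` dense (one-vertex data `Π_v = Π`: abc-iut-w5-d195's
  `vertCountLeNodeCountSucc_of_vertGp_eq_top`); origin level `vertCountLeNodeCountSuccHolds_of_twoVertex`.
* the MULTI-VERTEX instances at the genuine shapes of the tree — TWO-COMPONENT shape (abc-iut-f-165)
  and TWO-TRIPOD shape (abc-iut-L5-t6) — are the sequel `PSCVertCountConnectivityShapes.lean`.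

Group theory over the interface; consistency / instance evidence for the typed schema, not the printed
statement for all pointed stable curves; nothing here takes a side on [IUTchIII] Cor. 3.12.
-/

noncomputable section

namespace Literature.AnabelianGeometry.SemiGraphs

universe u

/-! ### A finite connected multigraph has `#V ≤ #E + 1` -/

namespace PSCCounting

/-- **Counting lemma.**  A multigraph given by endpoint maps `s t : E → V` with finitely many edges,
all of whose vertices are joined by chains of edges, has `#V ≤ #E + 1` (via the simple graph it
spans and Mathlib's spanning-tree count `SimpleGraph.Connected.card_vert_le_card_edgeSet_add_one`).
[cite: MochizukiCombGC2007, Rmk 1.1.3 p.8] -/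
theorem natCard_le_natCard_add_one_of_eqvGen {V E : Type*} [Finite E] (s t : E → V)
    (h : ∀ x y : V, Relation.EqvGen (fun a b => ∃ e, s e = a ∧ t e = b) x y) :
    Nat.card V ≤ Nat.card E + 1 := by
  classical
  rcases isEmpty_or_nonempty V with hV | hV
  · simp
  -- the simple graph spanned by the edges
  let Gr : SimpleGraph V := SimpleGraph.fromRel fun a b => ∃ e, s e = a ∧ t e = b
  have hreach : ∀ x y : V, Gr.Reachable x y := by
    intro x y
    induction h x y with
    | rel a b hab =>
      by_cases heq : a = b
      · exact heq ▸ SimpleGraph.Reachable.refl a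
      · exact SimpleGraph.Adj.reachable ((SimpleGraph.fromRel_adj _ a b).mpr ⟨heq, Or.inl hab⟩)
    | refl a => exact SimpleGraph.Reachable.refl a
    | symm a b _ ih => exact ih.symm
    | trans a b c _ _ ih₁ ih₂ => exact ih₁.trans ih₂
  have hconn : Gr.Connected := { preconnected := hreach }
  -- every edge of the simple graph comes from an edge of the multigraph
  let f : {e : E // s e ≠ t e} → Gr.edgeSet := fun e =>
    ⟨s(s e.1, t e.1), (SimpleGraph.mem_edgeSet Gr).mpr
      ((SimpleGraph.fromRel_adj _ _ _).mpr ⟨e.2, Or.inl ⟨e.1, rfl, rfl⟩⟩)⟩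
  have hf : Function.Surjective f := by
    rintro ⟨q, hq⟩
    induction q using Sym2.ind with
    | h a b =>
      obtain ⟨hne, ⟨e, rfl, rfl⟩ | ⟨e, rfl, rfl⟩⟩ :=
        (SimpleGraph.fromRel_adj _ a b).mp ((SimpleGraph.mem_edgeSet Gr).mp hq)
      · exact ⟨⟨e, hne⟩, rfl⟩
      · exact ⟨⟨e, fun h' => hne h'.symm⟩, Subtype.ext (Sym2.eq_swap)⟩
  calc Nat.card V ≤ Nat.card Gr.edgeSet + 1 := hconn.card_vert_le_card_edgeSet_add_one
    _ ≤ Nat.card {e : E // s e ≠ t e} + 1 := by gcongr; exact Nat.card_le_card_of_surjective f hf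
    _ ≤ Nat.card E + 1 := by gcongr; exact Finite.card_subtype_le _

end PSCCounting

namespace PSCDatum

open scoped Pointwise

variable {P : Type u} [Group P] [TopologicalSpace P] [IsTopologicalGroup P]

/-! ### The coset graphs `𝒯_U` are connected -/

omit [TopologicalSpace P] [IsTopologicalGroup P] in
/-- For `K ≤ K'` the double-coset relation of `U \ Π / K` refines that of `U \ Π / K'` (the
incidence maps `UgΠ_e ↦ UgΠ_v` of the coset graph are well defined when `Π_e ≤ Π_v`).
[cite: MochizukiCombGC2007, Def 1.1(ii) p.6] -/
theorem doubleCoset_rel_mono_right {U K K' : Subgroup P} (h : K ≤ K') {x y : P}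
    (hxy : DoubleCoset.setoid (U : Set P) (K : Set P) x y) :
    DoubleCoset.setoid (U : Set P) (K' : Set P) x y := by
  rw [DoubleCoset.rel_iff] at hxy ⊢
  obtain ⟨a, ha, b, hb, rfl⟩ := hxy
  exact ⟨a, ha, b, h hb, rfl⟩

/-- **The coset graph of a covering is connected.**  Let the nodes be oriented by `src, tgt`, the
vertex set connected along the nodes, and the vertex groups topologically generating `Π`.  Then for every open `U ≤ Π` any two vertices
`UgΠ_v`, `Ug'Π_{v'}` of the covering `G_U` are joined by a chain of nodes `UhΠ_e` (joining `UhΠ_{src e}`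
to `UhΠ_{tgt e}`). [cite: MochizukiCombGC2007, Rmk 1.1.3 p.8] -/
theorem eqvGen_doubleCoset_of_generate (G : PSCDatum P) (src tgt : G.graph.N → G.graph.V)
    (hconn : ∀ v w : G.graph.V, Relation.EqvGen (fun a b => ∃ e, src e = a ∧ tgt e = b) v w)
    (hgen : (⨆ v, G.vertGp v).topologicalClosure = ⊤) (U : Subgroup P) (hU : IsOpen (U : Set P)) :
    ∀ x y : (Σ v : G.graph.V, DoubleCoset.Quotient (U : Set P) (G.vertGp v : Set P)),
      Relation.EqvGen (fun a b => ∃ (e : G.graph.N) (g : P),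
        a = ⟨src e, DoubleCoset.mk U (G.vertGp (src e)) g⟩ ∧
          b = ⟨tgt e, DoubleCoset.mk U (G.vertGp (tgt e)) g⟩) x y := by
  classical
  -- the vertices `UgΠ_v`
  let ρ : P → G.graph.V → (Σ v : G.graph.V, DoubleCoset.Quotient (U : Set P) (G.vertGp v : Set P)) :=
    fun g v => ⟨v, DoubleCoset.mk U (G.vertGp v) g⟩
  -- (1) the base chain translated by `g`: `UgΠ_v ~ UgΠ_w`
  have step1 : ∀ (g : P) (v w : G.graph.V), Relation.EqvGen (fun a b => ∃ (e : G.graph.N) (g : P),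
      a = ⟨src e, DoubleCoset.mk U (G.vertGp (src e)) g⟩ ∧
        b = ⟨tgt e, DoubleCoset.mk U (G.vertGp (tgt e)) g⟩) (ρ g v) (ρ g w) := by
    intro g v w
    induction hconn v w with
    | rel a b hab =>
      obtain ⟨e, rfl, rfl⟩ := hab
      exact Relation.EqvGen.rel _ _ ⟨e, g, rfl, rfl⟩
    | refl a => exact Relation.EqvGen.refl _
    | symm a b _ ih => exact Relation.EqvGen.symm _ _ ih
    | trans a b c _ _ ih₁ ih₂ => exact Relation.EqvGen.trans _ _ _ ih₁ ih₂
  -- `UghΠ_w = UgΠ_w` for `h ∈ Π_w`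
  have hρ : ∀ (g h : P) (w : G.graph.V), h ∈ G.vertGp w → ρ (g * h) w = ρ g w := by
    intro g h w hh
    simp only [ρ, Sigma.mk.injEq, heq_eq_eq, true_and]
    exact (DoubleCoset.eq _ _ _ _).mpr ⟨1, U.one_mem, h⁻¹, (G.vertGp w).inv_mem hh, by group⟩
  intro x y
  rcases isEmpty_or_nonempty G.graph.V with hV | ⟨⟨v₀⟩⟩
  · exact (hV.false x.1).elim
  -- (2) every `g` in the subgroup generated by the `Π_v` has all its vertices in the component of `UΠ_{v₀}`
  have step2 : ∀ g ∈ Subgroup.closure (⋃ v, (G.vertGp v : Set P)), ∀ v,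
      Relation.EqvGen (fun a b => ∃ (e : G.graph.N) (g : P),
        a = ⟨src e, DoubleCoset.mk U (G.vertGp (src e)) g⟩ ∧
          b = ⟨tgt e, DoubleCoset.mk U (G.vertGp (tgt e)) g⟩) (ρ g v) (ρ 1 v₀) := by
    intro g hg
    refine Subgroup.closure_induction_right (p := fun g _ => ∀ v, Relation.EqvGen _ (ρ g v) (ρ 1 v₀))
      (fun v => step1 1 v v₀) ?_ ?_ hg
    · intro x _ y hy ih v
      obtain ⟨w, hw⟩ := Set.mem_iUnion.mp hy
      have h1 : ρ (x * y) w = ρ x w := hρ x y w hw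
      exact Relation.EqvGen.trans _ _ _ (step1 (x * y) v w) (h1 ▸ ih w)
    · intro x _ y hy ih v
      obtain ⟨w, hw⟩ := Set.mem_iUnion.mp hy
      have h1 : ρ (x * y⁻¹) w = ρ x w := hρ x y⁻¹ w ((G.vertGp w).inv_mem hw)
      exact Relation.EqvGen.trans _ _ _ (step1 (x * y⁻¹) v w) (h1 ▸ ih w)
  -- (3) density: every coset `Ug` meets that subgroup
  have step3 : ∀ g : P, ∃ d ∈ Subgroup.closure (⋃ v, (G.vertGp v : Set P)), ∃ u ∈ U, d = u * g := by
    intro g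
    have hD : Dense ((Subgroup.closure (⋃ v, (G.vertGp v : Set P)) : Subgroup P) : Set P) := by
      rw [Subgroup.iSup_eq_closure] at hgen
      have hc := congrArg SetLike.coe hgen
      rw [Subgroup.topologicalClosure_coe, Subgroup.coe_top] at hc
      exact dense_iff_closure_eq.mpr hc
    obtain ⟨d, hdO, hdD⟩ := hD.inter_open_nonempty {x | x * g⁻¹ ∈ (U : Set P)}
      (hU.preimage (continuous_id.mul continuous_const)) ⟨g, by simp [U.one_mem]⟩
    exact ⟨d, hdD, d * g⁻¹, hdO, by group⟩
  -- (4) every vertex lies in the component of `UΠ_{v₀}`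
  have step4 : ∀ z : (Σ v : G.graph.V, DoubleCoset.Quotient (U : Set P) (G.vertGp v : Set P)),
      Relation.EqvGen (fun a b => ∃ (e : G.graph.N) (g : P),
        a = ⟨src e, DoubleCoset.mk U (G.vertGp (src e)) g⟩ ∧
          b = ⟨tgt e, DoubleCoset.mk U (G.vertGp (tgt e)) g⟩) z (ρ 1 v₀) := by
    rintro ⟨v, q⟩
    induction q using Quotient.inductionOn' with
    | h g =>
      obtain ⟨d, hd, u, hu, rfl⟩ := step3 g
      have h1 : (⟨v, Quotient.mk'' g⟩ : Σ v : G.graph.V,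
          DoubleCoset.Quotient (U : Set P) (G.vertGp v : Set P)) = ρ (u * g) v := by
        simp only [ρ, Sigma.mk.injEq, heq_eq_eq, true_and]
        exact (DoubleCoset.eq _ _ _ _).mpr ⟨u, hu, 1, (G.vertGp v).one_mem, by group⟩
      rw [h1]
      exact step2 _ hd v
  exact Relation.EqvGen.trans _ _ _ (step4 x) (Relation.EqvGen.symm _ _ (step4 y))

/-! ### The criterion -/

/-- **[CombGC] Rmk. 1.1.3 / [IUTchI] Rmk. 1.2.3 (i) — `i(G_U) ≤ n(G_U) + 1` from generation.**  Let
`G : PSCDatum Π`, `Π` compact.  If the nodes admit an orientation `src, tgt` with TREE-ALIGNED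
representatives `Π_e ≤ Π_{src e}`, `Π_e ≤ Π_{tgt e}` along which the vertex set is connected, and the
vertex groups `Π_v` topologically generate `Π` — exactly the shape of the representatives that
Def. 1.1 extracts from the graph of (profinite) groups of a pointed stable curve along a spanning tree
of its (connected) dual graph when the latter is a tree — then every covering `G_U` (`U` open) has
`i(G_U) ≤ n(G_U) + 1`: `G.VertCountLeNodeCountSucc`.  (The coset graph `𝒯_U` is connected,
`eqvGen_doubleCoset_of_generate`, and finite: `#V ≤ #E + 1`.) [cite: MochizukiCombGC2007, Rmk 1.1.3 p.8] -/
theorem vertCountLeNodeCountSucc_of_generate [CompactSpace P] (G : PSCDatum P)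
    (src tgt : G.graph.N → G.graph.V)
    (hsrc : ∀ e, G.nodeGp e ≤ G.vertGp (src e)) (htgt : ∀ e, G.nodeGp e ≤ G.vertGp (tgt e))
    (hconn : ∀ v w : G.graph.V, Relation.EqvGen (fun a b => ∃ e, src e = a ∧ tgt e = b) v w)
    (hgen : (⨆ v, G.vertGp v).topologicalClosure = ⊤) :
    G.VertCountLeNodeCountSucc := by
  classical
  intro U hU
  haveI : Finite (P ⧸ U) := Subgroup.quotient_finite_of_isOpen U hU
  haveI : U.FiniteIndex := Subgroup.finiteIndex_of_finite_quotient
  haveI : ∀ v, Finite (DoubleCoset.Quotient (U : Set P) (G.vertGp v : Set P)) := fun v =>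
    PSCCounting.finite_doubleCoset_quotient U (G.vertGp v)
  haveI : ∀ e, Finite (DoubleCoset.Quotient (U : Set P) (G.nodeGp e : Set P)) := fun e =>
    PSCCounting.finite_doubleCoset_quotient U (G.nodeGp e)
  -- the incidence maps of the coset graph `𝒯_U`
  let s : (Σ e : G.graph.N, DoubleCoset.Quotient (U : Set P) (G.nodeGp e : Set P)) →
      (Σ v : G.graph.V, DoubleCoset.Quotient (U : Set P) (G.vertGp v : Set P)) := fun x =>
    ⟨src x.1, Quotient.map' id (fun a b hab => doubleCoset_rel_mono_right (hsrc x.1) hab) x.2⟩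
  let t : (Σ e : G.graph.N, DoubleCoset.Quotient (U : Set P) (G.nodeGp e : Set P)) →
      (Σ v : G.graph.V, DoubleCoset.Quotient (U : Set P) (G.vertGp v : Set P)) := fun x =>
    ⟨tgt x.1, Quotient.map' id (fun a b hab => doubleCoset_rel_mono_right (htgt x.1) hab) x.2⟩
  have hst : ∀ x y, Relation.EqvGen (fun a b => ∃ ε, s ε = a ∧ t ε = b) x y := by
    intro x y
    refine Relation.EqvGen.mono (fun a b hab => ?_) x y
      (eqvGen_doubleCoset_of_generate G src tgt hconn hgen U hU x y)
    obtain ⟨e, g, rfl, rfl⟩ := hab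
    exact ⟨⟨e, DoubleCoset.mk U (G.nodeGp e) g⟩, rfl, rfl⟩
  have hle := PSCCounting.natCard_le_natCard_add_one_of_eqvGen s t hst
  rw [Nat.card_sigma, Nat.card_sigma] at hle
  exact hle

/-! ### Two-vertex data

One-vertex data with `Π_v = Π` (the smooth-proper / smooth-curve / irreducible-nodal shapes of the cell's
NV programme) are covered by abc-iut-w5-d195's `vertCountLeNodeCountSucc_of_vertGp_eq_top`
(`PSCSmoothCurveGenuineRank.lean`) and are the case `v₁ = v₂` below. -/

/-- **Two-vertex data.**  If every vertex is `v₁` or `v₂`, there is at least one node, every node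
group lies in both `Π_{v₁}` and `Π_{v₂}` (tree-aligned representatives of the one-node tree), and
`Π_{v₁}`, `Π_{v₂}` topologically generate `Π` (compact), then every covering `G_U` has
`i(G_U) ≤ n(G_U) + 1`. [cite: MochizukiCombGC2007, Rmk 1.1.3 p.8] -/
theorem vertCountLeNodeCountSucc_of_twoVertex [CompactSpace P] (G : PSCDatum P) (v₁ v₂ : G.graph.V)
    (hV : ∀ w, w = v₁ ∨ w = v₂) (e₀ : G.graph.N)
    (hN : ∀ e, G.nodeGp e ≤ G.vertGp v₁ ∧ G.nodeGp e ≤ G.vertGp v₂)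
    (hgen : (G.vertGp v₁ ⊔ G.vertGp v₂).topologicalClosure = ⊤) : G.VertCountLeNodeCountSucc := by
  refine vertCountLeNodeCountSucc_of_generate G (fun _ => v₁) (fun _ => v₂) (fun e => (hN e).1)
    (fun e => (hN e).2) ?_ ?_
  · -- the vertex set `{v₁, v₂}` is connected through `e₀`
    have hto : ∀ w, Relation.EqvGen (fun a b : G.graph.V => ∃ _ : G.graph.N, v₁ = a ∧ v₂ = b) w v₁ := by
      intro w
      rcases hV w with rfl | rfl
      · exact Relation.EqvGen.refl _
      · exact Relation.EqvGen.symm _ _ (Relation.EqvGen.rel _ _ ⟨e₀, rfl, rfl⟩)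
    exact fun v w => Relation.EqvGen.trans _ _ _ (hto v) (Relation.EqvGen.symm _ _ (hto w))
  · rw [eq_top_iff, ← hgen]
    exact Subgroup.topologicalClosure_minimal _
      ((sup_le (le_iSup (fun v => G.vertGp v) v₁) (le_iSup (fun v => G.vertGp v) v₂)).trans
        (Subgroup.le_topologicalClosure _)) (Subgroup.isClosed_topologicalClosure _)

/-- Topological generation along a dense homomorphism: if `A₁ ⊔ A₂ = ⊤` in `Γ` and `ι : Γ → Π` has
dense image, the closures of `ι(A₁)`, `ι(A₂)` topologically generate `Π`.
[cite: MochizukiCombGC2007, Rmk 1.1.3 p.8] -/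
theorem topologicalClosure_sup_eq_top_of_dense {Γ : Type*} [Group Γ] (ι : Γ →* P)
    (hι : Dense (Set.range ι)) {A₁ A₂ : Subgroup Γ} (hA : A₁ ⊔ A₂ = ⊤) :
    ((A₁.map ι).topologicalClosure ⊔ (A₂.map ι).topologicalClosure).topologicalClosure = ⊤ := by
  have hdense : (ι.range).topologicalClosure = ⊤ := by
    rw [← SetLike.coe_set_eq, Subgroup.topologicalClosure_coe, Subgroup.coe_top, MonoidHom.coe_range]
    exact hι.closure_eq
  rw [eq_top_iff, ← hdense]
  refine Subgroup.topologicalClosure_minimal _ ?_ (Subgroup.isClosed_topologicalClosure _)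
  rw [MonoidHom.range_eq_map, ← hA, Subgroup.map_sup]
  exact (sup_le_sup (Subgroup.le_topologicalClosure _) (Subgroup.le_topologicalClosure _)).trans
    (Subgroup.le_topologicalClosure _)

/-! ### Origin level -/

section Origin

variable (Ω : PSCOrigin.{u})

/-- **F-3811 `VertCountLeNodeCountSuccHolds Ω` at every origin of two-vertex data with aligned,
generating representatives** (compact carriers; every vertex `v₁` or `v₂`, a node, every node group in
`Π_{v₁} ∩ Π_{v₂}`, `Π_{v₁} · Π_{v₂}` dense) — e.g. origins of two-component or two-tripod shape.
[cite: MochizukiCombGC2007, Rmk 1.1.3 p.8] -/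
theorem vertCountLeNodeCountSuccHolds_of_twoVertex
    (hΩ : ∀ ⦃Q : Type u⦄ [Group Q] [TopologicalSpace Q] [IsTopologicalGroup Q] (G : PSCDatum Q),
      Ω.IsOfPSCType G → CompactSpace Q ∧ ∃ (v₁ v₂ : G.graph.V) (_ : G.graph.N),
        (∀ w, w = v₁ ∨ w = v₂) ∧ (∀ e, G.nodeGp e ≤ G.vertGp v₁ ∧ G.nodeGp e ≤ G.vertGp v₂) ∧
        (G.vertGp v₁ ⊔ G.vertGp v₂).topologicalClosure = ⊤) :
    VertCountLeNodeCountSuccHolds Ω := by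
  intro Q _ _ _ G hG
  obtain ⟨hc, v₁, v₂, e₀, hV, hN, hgen⟩ := hΩ G hG
  exact vertCountLeNodeCountSucc_of_twoVertex G v₁ v₂ hV e₀ hN hgen

end Origin

end PSCDatum

end Literature.AnabelianGeometry.SemiGraphs

end
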